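import Literature.Geometry.Lorentzian.TeukolskyOutgoingCorrection
import Literature.Geometry.Lorentzian.TeukolskyNormalisedHorizonExists
import HarnessLib

/-!
# Existence of the radial solution normalised at `𝓘⁺` (Teixeira da Costa 2020, Def. 2.3 / Lemma 2.2),
# scalar case `s = 0`, `|a| < M`, real `ω ≠ 0` — and of the normalised pair `(R_{𝓗⁺}, R_{𝓘⁺})`

Namespace `Literature.Geometry.Lorentzian.Kerr`. For `M > 0`, `|a| < M`, real `ω ≠ 0`, `m`, `λ`, this file
PROVES that the homogeneous radial Teukolsky ODE with `s = 0` has a classical solution on `(r₊, ∞)` with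
the FULL outgoing asymptotic expansion of [Costa2019, Def. 2.3, footnote]: one sequence `(cₖ)`, `c₀ = 1`,
with `R(r) = e^{iωr} r^{2iMω} Σ_{k≤N} cₖ r^{−k−1} + O(r^{−N−2})` for EVERY `N ≥ 1`
(`Kerr.IsNormalisedInfinitySolution M 0 ω R`): `Kerr.exists_normalisedInfinitySolution`. TdC Lemma 2.2 /
DRSR arXiv:1402.7034 §5.3 (`u_out`) call this "standard asymptotic ODE analysis" (Olver Ch. 7 §2); the
proof assembled here:

* `cₖ = outgoingCoeff M a ω m λ 1` (the formal recursion, `TeukolskyOutgoingFormalSeries.lean`), whose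
  truncations `P_N` solve the ODE up to `O(r^{−N−1})`;
* for every large `N` an EXACT solution `S_N` with `S_N − P_N, S_N′ − P_N′ = O(r^{2p−N})`
  (`Costa2019.exists_corrected_truncation`, `TeukolskyOutgoingCorrection.lean`; `p` a growth exponent of a
  basis of solutions);
* `R := S_{1+D}` for a shift `D ≥ 3 max(p, p₀) + 3`; for each `N ≥ 1` the difference `R − S_{N+D}` is a
  solution decaying like `r^{−(max(p,p₀)+3)}` together with its derivative, hence ZERO
  (`Costa2019.radial_eq_zero_of_decay`, `TeukolskyRadialContinuation.lean`), so
  `R − P_N = (S_{N+D} − P_{N+D}) + (P_{N+D} − P_N) = O(r^{−N−2})`.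

Finally `Kerr.normalisedPair_exists` pairs it with `Kerr.exists_normalisedHorizonSolution`
(`TeukolskyNormalisedHorizonExists.lean`) in the format consumed by the `KappaExplicitWaveDecay` crux
(S6a′: the TdC-normalised pair `(R_{𝓗⁺}, R_{𝓘⁺})` exists for every `M > 0`, `|a| < M`, `ω ≠ 0`, `m ∈ ℤ`,
`Λ`, with `λ = Λ − a²ω²`), which makes the cone hypotheses quantified over such pairs — and the named fact
`Kerr.Costa2019_wronskianBound_subextremal` — non-vacuous.

## References
* R. Teixeira da Costa, CMP 378 (2020) 705–781 = arXiv:1910.02854, Def. 2.3 (and footnote), Lemma 2.2.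
  [Costa2019]
* M. Dafermos, I. Rodnianski, Y. Shlapentokh-Rothman, arXiv:1402.7034 = Ann. of Math. 183 (2016), §5.3.
  [DafermosRodnianskiShlapentokhrothman2014]
* F. W. J. Olver, *Asymptotics and Special Functions* (1974), Ch. 7 §2. [Olver1974]
-/

noncomputable section

open Complex Set Filter

namespace Literature.Geometry.Lorentzian.Kerr

open Costa2019

/-- Monotonicity of real powers in the exponent for bases `≥ 1`, with a nonnegative constant. [folklore] -/
theorem mul_rpow_le_mul_rpow_of_le {K x e₁ e₂ : ℝ} (hK : 0 ≤ K) (hx : 1 ≤ x) (he : e₁ ≤ e₂) :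
    K * x ^ e₁ ≤ K * x ^ e₂ :=
  mul_le_mul_of_nonneg_left (Real.rpow_le_rpow_of_exponent_le hx he) hK

/-- A constant dominating a norm times a positive power is nonnegative. [folklore] -/
theorem nonneg_of_norm_le_const_mul_rpow {u : ℂ} {K x e : ℝ} (hx : 0 < x) (h : ‖u‖ ≤ K * x ^ e) : 0 ≤ K :=
  (mul_nonneg_iff_of_pos_right (Real.rpow_pos_of_pos hx e)).1 ((norm_nonneg u).trans h)

/-- **Existence of `R_{𝓘⁺}` (Teixeira da Costa Def. 2.3 / Lemma 2.2, `s = 0`, `|a| < M`, real `ω ≠ 0`).**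
For `M > 0`, `|a| < M`, `ω ≠ 0` and real `m, λ` there is a classical solution `R` of the homogeneous radial
Teukolsky ODE with `s = 0` on `(r₊, ∞)` normalised at future null infinity: there are coefficients `cₖ` with
`|c₀| = 1` such that for every `N ≥ 1`, `R(r) = e^{iωr + 2iMω log r} Σ_{k≤N} cₖ r^{−k−1} + O(r^{−N−2})`
("`R_{𝓘⁺} ∼ e^{iωr} r^{2Miω−2s−1}`", Lemma 2.2: "a unique solution … defined through an asymptotic
series at `r = ∞`"). [cite: Costa2019, Definition 2.3 and Lemma 2.2] -/
theorem exists_normalisedInfinitySolution {M a : ℝ} (hM : 0 < M) (ha : |a| < M) {ω : ℝ} (hω : ω ≠ 0)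
    (m lam : ℝ) :
    ∃ R : ℝ → ℂ, IsRadialTeukolskySolution M a 0 ω m lam R ∧ IsNormalisedInfinitySolution M 0 ω R := by
  set c := outgoingCoeff M a ω m lam 1 with hc
  obtain ⟨p, X, hp, hX, hcorr⟩ := exists_corrected_truncation hM ha hω m lam 1
  obtain ⟨p₀, hp₀, hvan⟩ := radial_eq_zero_of_decay hM ha hω m lam
  have hrp : 0 < rPlus M a := rPlus_pos hM a
  have hX1 : 1 ≤ X := by linarith
  have hXr : rPlus M a < X := by linarith
  set Pb : ℝ := max p p₀ with hPb
  have hPb0 : 0 ≤ Pb := le_max_of_le_left hp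
  have hpP : p ≤ Pb := le_max_left _ _
  have hp₀P : p₀ ≤ Pb := le_max_right _ _
  set D : ℕ := ⌈3 * Pb⌉₊ + 3 with hD
  have hD3 : 3 * Pb + 3 ≤ (D : ℝ) := by
    rw [hD]; push_cast; linarith [Nat.le_ceil (3 * Pb)]
  have hDp : ∀ n : ℕ, p < ((n + D : ℕ) : ℝ) := fun n => by
    push_cast; have : (0 : ℝ) ≤ n := Nat.cast_nonneg n; linarith
  -- the solution: the corrected truncation at order `1 + D`
  obtain ⟨R, R', hR, K, hK⟩ := hcorr (1 + D) (hDp 1)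
  refine ⟨R, isRadialTeukolskySolution_of_normalForm ha.le hR, c, by rw [hc, outgoingCoeff_zero, norm_one],
    fun N₁ hN₁ => ?_⟩
  obtain ⟨S, S', hS, K', hK'⟩ := hcorr (N₁ + D) (hDp N₁)
  obtain ⟨C₁, hC₁, hd₁⟩ := outgoingP_sub_le M ω c (N := 1 + D) (N' := N₁ + D) (by omega)
  obtain ⟨C₂, hC₂, hd₂⟩ := outgoingP_sub_le M ω c (N := N₁) (N' := N₁ + D) (by omega)
  have hK0 : 0 ≤ K := nonneg_of_norm_le_const_mul_rpow (by linarith) (hK (X + 1) (by linarith)).1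
  have hK'0 : 0 ≤ K' := nonneg_of_norm_le_const_mul_rpow (by linarith) (hK' (X + 1) (by linarith)).1
  have hN₁r : (1 : ℝ) ≤ N₁ := by exact_mod_cast hN₁
  -- exponent bookkeeping
  have ea : 2 * p - ((1 + D : ℕ) : ℝ) ≤ -(Pb + 3) := by push_cast; linarith
  have eb : -((1 + D : ℕ) : ℝ) - 2 ≤ -(Pb + 3) := by push_cast; linarith
  have ec : 2 * p - ((N₁ + D : ℕ) : ℝ) ≤ -(Pb + 3) := by push_cast; linarith
  have ed : 2 * p - ((N₁ + D : ℕ) : ℝ) ≤ -(N₁ : ℝ) - 2 := by push_cast; linarith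
  -- `R = S` on `(r₊, ∞)`: the difference decays like `r^{−(Pb+3)}` and is a solution
  have hZ : ∀ t ∈ Ioi (rPlus M a), HasDerivAt (fun r => R r - S r) (R' t - S' t) t ∧
      HasDerivAt (fun r => R' r - S' r)
        (radialNFp M a 0 t * (R' t - S' t) + radialNFq M a 0 ω m lam t * (R t - S t)) t := fun t ht =>
    ⟨(hR t ht).1.sub (hS t ht).1, ((hR t ht).2.sub (hS t ht).2).congr_deriv (by ring)⟩
  have hZsol := isRadialTeukolskySolution_of_normalForm ha.le hZ
  have hZd : ∀ t, rPlus M a < t → deriv (fun r => R r - S r) t = R' t - S' t := fun t ht => (hZ t ht).1.deriv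
  have hRS : ∀ r, rPlus M a < r → R r - S r = 0 := by
    refine hvan (fun r => R r - S r) (K + C₁ + K') (X + 1) (Pb + 3) (by linarith) hZsol fun x hx => ?_
    have hxX : X < x := by linarith
    have hx1 : 1 ≤ x := by linarith
    have hxp : rPlus M a < x := by linarith
    obtain ⟨a₁, a₂⟩ := hK x hxX
    obtain ⟨b₁, b₂⟩ := hd₁ x hx1
    obtain ⟨c₁, c₂⟩ := hK' x hxX
    rw [hZd x hxp]
    have key : ∀ (u P₁ P₂ v : ℂ), ‖u - P₁‖ ≤ K * x ^ (2 * p - ((1 + D : ℕ) : ℝ)) →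
        ‖P₂ - P₁‖ ≤ C₁ * x ^ (-((1 + D : ℕ) : ℝ) - 2) → ‖v - P₂‖ ≤ K' * x ^ (2 * p - ((N₁ + D : ℕ) : ℝ)) →
        ‖u - v‖ ≤ (K + C₁ + K') * x ^ (-(Pb + 3)) := by
      intro u P₁ P₂ v h1 h2 h3
      have h1' := h1.trans (mul_rpow_le_mul_rpow_of_le hK0 hx1 ea)
      have h2' := h2.trans (mul_rpow_le_mul_rpow_of_le hC₁ hx1 eb)
      have h3' := h3.trans (mul_rpow_le_mul_rpow_of_le hK'0 hx1 ec)
      calc ‖u - v‖ ≤ ‖u - P₂‖ + ‖P₂ - v‖ := norm_sub_le_norm_sub_add_norm_sub _ _ _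
        _ ≤ (‖u - P₁‖ + ‖P₁ - P₂‖) + ‖P₂ - v‖ := by
            gcongr; exact norm_sub_le_norm_sub_add_norm_sub _ _ _
        _ = ‖u - P₁‖ + ‖P₂ - P₁‖ + ‖v - P₂‖ := by rw [norm_sub_rev P₁ P₂, norm_sub_rev P₂ v]
        _ ≤ (K + C₁ + K') * x ^ (-(Pb + 3)) := by linarith
    exact ⟨key _ _ _ _ a₁ b₁ c₁, key _ _ _ _ a₂ b₂ c₂⟩
  -- the expansion to order `N₁`
  refine ⟨K' + C₂, X + 1, fun r hr => ?_⟩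
  have hrX : X < r := by linarith
  have hr1 : 1 ≤ r := by linarith
  have hrp' : rPlus M a < r := by linarith
  have hReq : R r = S r := sub_eq_zero.1 (hRS r hrp')
  rw [hReq, ← outgoingP_eq M 0 ω c N₁ r, show (-(2 * (0 : ℝ)) - (N₁ : ℝ) - 2) = -(N₁ : ℝ) - 2 by ring]
  obtain ⟨c₁, -⟩ := hK' r hrX
  obtain ⟨e₁, -⟩ := hd₂ r hr1
  have c₁' := c₁.trans (mul_rpow_le_mul_rpow_of_le hK'0 hr1 ed)
  calc ‖S r - outgoingP M 0 ω c N₁ r‖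
      = ‖(S r - outgoingP M 0 ω c (N₁ + D) r) + (outgoingP M 0 ω c (N₁ + D) r - outgoingP M 0 ω c N₁ r)‖ := by
        ring_nf
    _ ≤ ‖S r - outgoingP M 0 ω c (N₁ + D) r‖ + ‖outgoingP M 0 ω c (N₁ + D) r - outgoingP M 0 ω c N₁ r‖ :=
        norm_add_le _ _
    _ ≤ K' * r ^ (-(N₁ : ℝ) - 2) + C₂ * r ^ (-(N₁ : ℝ) - 2) := add_le_add c₁' e₁
    _ = (K' + C₂) * r ^ (-(N₁ : ℝ) - 2) := by ring

/-- **The TdC-normalised pair `(R_{𝓗⁺}, R_{𝓘⁺})` exists** (scalar case `s = 0`, `|a| < M`, `ω ≠ 0`,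
`m ∈ ℤ`, angular parameter `λ = Λ − a²ω²`): for every `M > 0`, subextremal `a`, real `ω ≠ 0`, `m : ℤ`,
`Λ : ℝ` there are classical solutions `R_𝓗`, `R_𝓘` of the homogeneous radial Teukolsky ODE on `(r₊, ∞)`
normalised at `𝓗⁺` resp. `𝓘⁺` in the sense of Teixeira da Costa's Def. 2.3
(`Kerr.IsNormalisedHorizonSolution`, `Kerr.IsNormalisedInfinitySolution`) — the objects over which TdC's
Theorem 5.1 (`Kerr.Costa2019_wronskianBound_subextremal`) and the cone hypotheses of the
`KappaExplicitWaveDecay` crux quantify. [cite: Costa2019, Definition 2.3 and Lemma 2.2] -/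
theorem normalisedPair_exists :
    ∀ (M a ω : ℝ) (m : ℤ) (Λ : ℝ), 0 < M → IsSubextremal M a → ω ≠ 0 →
      ∃ RH RI : ℝ → ℂ,
        IsRadialTeukolskySolution M a 0 ω m (Λ - a ^ 2 * ω ^ 2) RH ∧ IsNormalisedHorizonSolution M a 0 ω m RH ∧
        IsRadialTeukolskySolution M a 0 ω m (Λ - a ^ 2 * ω ^ 2) RI ∧ IsNormalisedInfinitySolution M 0 ω RI := by
  intro M a ω m Λ hM hMa hω
  obtain ⟨RH, hH, hHn⟩ := exists_normalisedHorizonSolution hM hMa ω m (Λ - a ^ 2 * ω ^ 2)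
  obtain ⟨RI, hI, hIn⟩ := exists_normalisedInfinitySolution hM hMa hω m (Λ - a ^ 2 * ω ^ 2)
  exact ⟨RH, RI, hH, hHn, hI, hIn⟩

end Literature.Geometry.Lorentzian.Kerr

end
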